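import Summits.QuantumFields.BalabanUV.Beta.EriceRemainderEnclosureHistoryAutonomyComparisonAgeCompositionStaticEndDecayFlow

/-!
# EriceRemainderEnclosureHistoryAutonomyComparisonAgeCompositionDecayReduction — (E84a) route (N), first order: THE STATIC DECAY FAMILY (S-d) ALONG A
# TWO-AGE FLOW REDUCED TO A DAMPING-FREE PRODUCT INEQUALITY IN THE LEVELS AND THE LOADS — every damping taken at its own worst end of the relaxed class
# (the window damping of the old row at the floor, the entering entries undamped, the chain's growth factor at its flow majorant `Hup`), which the
# census numerics show costs nothing at the extremal configurations

Cell `pub-balaban`, β-function sub-cell, BINDER row D4 «RemainderConst leaves for Bałaban's split» (`HOME/BINDER-OWNERS.md`; owner lineage `b2b-balaban-beta-an4`;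
this file by co-owner #2 lineage `b2b-balaban-beta-d4-p2`, generation 75), β-FLOW TEAM duty (1), FREEZE (0) honoured (def-free; imports (E83k)
`…StaticEndDecayFlow`; uses (E75a) `defect_nonneg`, (E82b) `kernel_entry_le` ∕ `row_mass_le` ∕ `load_le_of_window`, (E82c) `Hg_one` and (E83k)
`flow_nonneg_two_ages_decay` BY NAME; nothing restated).  Successor item (1) of README `HOME/b2b-balaban-beta-d4-p2/g74/e83/README.md` §4, first layer.

HONEST FRAMING (page 1, verbatim and binding).  *"Discharging BetaPertH makes Bałaban's UV stability UNCONDITIONAL — a real constructive-QFT result; it is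
NOT the continuum limit and NOT the Clay problem."*  THIS FILE DISCHARGES NOTHING OF THE KIND.  Elementary real analysis about ABSTRACT functionals on a box
]0,γ]^ℕ with displayed floors, profiles and signs, and the FIRST-ORDER renewal objects of route (N) built from them — hypotheses of a census, not facts; the
form, signs, ages and moments of Bałaban's (1.22) limit functional are NOT PRINTED ([I] p. 298; GAPS G-t4-U2-1∕-2) and NOT asserted.  Row D4 class
UNCHANGED (critical-path width 0; instance 0∕1; D4 DISCHARGE NO DATE).  HONEST DEPENDENCY: continuum YM on T⁴ ⇐ BetaPertH ∧ nine spine estimates (0/9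
proved); BetaPertH ⇐ (D1) ∧ (D4) ∧ CAP+tail; G-an2-4 gates asym, D1 and NE2/3/4.

THE POINT (census sense (α); route (N); README `HOME/b2b-balaban-beta-d4-p2/g75/e84/README.md`).  (E83k) `flow_nonneg_two_ages_decay` leaves the damped
two-age END resting on ONE static family, (S-d): at every pin `m`,
`KL k (m+1) (k−1)·KL 1 (m+1+k) 0·Π_{p∈[m+2,m+2+k)} Hg 1 p ≤ KL k m 0·KL 1 (m+1) 0·(1 − KL 1 (m+2) 0·Hg 1 (m+2))`.  Along the flow every factor is a displayed
function of the levels `a = 1∕h²`, the loads and the dampings; the dampings of the relaxed class `1∕(1+F_t) ≤ g_t ≤ 1` (`F_t = Σ_j L_jh_{t+j}³∕2`) enter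
the two sides in OPPOSITE directions and at DISJOINT depths, so each may be taken at its own worst end.  With `c_n = L_kh_{n+k}³∕2` (old coefficient),
`d_n = L_1h_{n+1}³∕2` (young coefficient), `x_p = k·c_p` (undamped window mass) and the FLOW MAJORANT OF THE GROWTH FACTOR
**`Hup_p = (1 + ϑ_p·x_p∕(1−x_p))∕(1 − c_p)`, `ϑ_p = 1 − (h_{p+k+1}∕h_{p+k})³∕(1 + F_{p+k+1})`** (§2 **`Hg_one_le`**: `0 ≤ Hg 1 p ≤ Hup_p` at every pin
`p ≥ 1` — (E82c) `Hg_one`, the defect's damping at its floor, the damped row mass below the undamped one ((E82b) `row_mass_le`), `x_p ≤ 3∕4` ((E82b)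
`load_le_of_window`), the lag-zero entry below `c_p`), §3 **`static_decay_of_product`**: (S-d) at the pin `m` FOLLOWS from the damping-free inequality
**(★)  `c_{m+1}·d_{m+1+k}·Π_{p∈[m+2,m+2+k)} Hup_p ≤ c_m·d_{m+1}·(Π_{t∈[m+1,m+k+1)}(1+F_t))⁻¹·(1+F_{m+2})⁻¹·(1 − d_{m+2}·Hup_{m+2})`**
(entering entry undamped, leaving entry with its whole window at the floor, young entries likewise; `1 − d_{m+2}Hup_{m+2} ≥ 0`), and §4
**`flow_nonneg_two_ages_of_product`**: the two-age END of (E83k) with (S-d) replaced by (★) at every pin.  NUMERICS OF RECORD (`g75/numerics/sd_core.py`,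
`p3.py`, `p4.py`; kit j330859, j330889; adversary = concave level sequence × loads at any fraction of feasibility × every damping of the relaxed class, pin
`m = 0` (the least constrained), `k ≤ 32`): the exact (S-d) has `min ln(RHS∕LHS) = +0.15…+0.35` in units of the entering activity
`S = Σ log-steps + Σ ln(1+F)` and is never violated; (★) — every damping decoupled — has THE SAME minima (+0.15…+0.37): the worst configurations already sit
at the decoupled vertex (old window at the floor on `[m+1,m+k]` and `[m+k+3,m+2k+2]`, undamped at `m+k+1`, `m+k+2`).  So (★) is the right target for the
successor layers ((E84b): its logarithmic budget; (E84c): the budget along flows).  NOT CLAIMED: (★) along flows; three or more loaded ages; anything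
nonlinear; anything printed.

WHAT IS PROVED ([folklore]; 0 `def`, 0 sorry).  §1 `inv_prod_le_prod_damping`; §2 **`Hg_one_le`**; §3 **`static_decay_of_product`**;
§4 **`flow_nonneg_two_ages_of_product`**.
-/
noncomputable section
open Finset

namespace Summit.QuantumFields.BalabanUV.Beta.EriceRemainderEnclosureHistoryAutonomyComparisonAgeCompositionDecayReduction

open Literature.MathematicalPhysics.QuantumFieldTheory.Balaban1983to89
open Literature.MathematicalPhysics.QuantumFieldTheory.Balaban1983to89.T4BetaStationary
open Literature.MathematicalPhysics.QuantumFieldTheory.Balaban1983to89.T4BetaFlowWellPosed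
open Summit.QuantumFields.BalabanUV.Beta.EriceRemainderEnclosureHistoryAutonomyOrder (strictAnti_of_memFlow)
open Summit.QuantumFields.BalabanUV.Beta.EriceRemainderEnclosureHistoryAutonomyComparisonAgeCompositionIdentification (defect_nonneg prod_damping_pos
  prod_damping_le_one)
open Summit.QuantumFields.BalabanUV.Beta.EriceRemainderEnclosureHistoryAutonomyComparisonAgeCompositionYoungestTailSumFlow (kernel_entry_le row_mass_le
  load_le_of_window)
open Summit.QuantumFields.BalabanUV.Beta.EriceRemainderEnclosureHistoryAutonomyComparisonAgeCompositionYoungestTailSumWiring (Hg_one)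
open Summit.QuantumFields.BalabanUV.Beta.EriceRemainderEnclosureHistoryAutonomyComparisonAgeCompositionStaticEndDecayFlow (flow_nonneg_two_ages_decay)

variable {B : (ℕ → ℝ) → ℝ} {γ b gIR : ℝ} {L : ℕ → ℝ} {K : ℕ} {h g : ℕ → ℝ} {KL θ : ℕ → ℕ → ℕ → ℝ}

/-! ## §1 The relaxed floor across a window -/

/-- The relaxed floor across a window: `(Π_{t∈s}(1+F_t))⁻¹ ≤ Π_{t∈s} g_t` when `1∕(1+F_t) ≤ g_t` and `F_t ≥ 0`. [folklore] -/
theorem inv_prod_le_prod_damping {F : ℕ → ℝ} (hF0 : ∀ t, 0 ≤ F t) (hgF : ∀ t, 1 / (1 + F t) ≤ g t) (s : Finset ℕ) :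
    (∏ t ∈ s, (1 + F t))⁻¹ ≤ ∏ t ∈ s, g t := by
  rw [← prod_inv_distrib]
  exact prod_le_prod (fun t _ => by have := hF0 t; positivity) fun t _ => by rw [inv_eq_one_div]; exact hgF t

/-! ## §2 The flow majorant of the chain's growth factor at the youngest age -/

/-- **THE GROWTH FACTOR BELOW ITS FLOW MAJORANT.**  Two-age profile `{1, k}` (`2 ≤ k < K`, `L_j = 0` otherwise), `h` a box solution of an isotone memory
with floor dominated by `L ≥ 0`, any damping of the relaxed class, the chain `ρ`, `β` and the growth factors `Hg` of (E81k) displayed as there.  Then at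
every pin `p ≥ 1`:  `0 ≤ Hg 1 p ≤ Hup_p = (1 + ϑ_p·x_p∕(1−x_p))∕(1 − c_p)` with `c_p = L_kh_{p+k}³∕2`, `x_p = k·c_p`,
`ϑ_p = 1 − (h_{p+k+1}∕h_{p+k})³∕(1 + F_{p+k+1})` — by (E82c) `Hg_one` (`Hg 1 p = (1 + θ_k(p;1)·x̃∕(1−x̃))∕(1 − KL k p 0)`), `0 ≤ θ_k(p;1) ≤ ϑ_p` (the one
damping in the defect at its floor), `0 ≤ x̃ ≤ x_p ≤ 3∕4` ((E82b) `row_mass_le`, `load_le_of_window`) and `0 ≤ KL k p 0 ≤ c_p ≤ x_p∕2`. [folklore] -/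
theorem Hg_one_le (hmono : ∀ u v : ℕ → ℝ, SeqBox γ u → SeqBox γ v → (∀ j, u j ≤ v j) → B u ≤ B v)
    (hL : ∀ k, 0 ≤ L k) (hb : 0 < b) (hlo : ∀ u, SeqBox γ u → b ≤ B u) (hdom : ∀ u, SeqBox γ u → ∑ k ∈ range K, L k * u k ≤ B u)
    (hh : SeqBox γ h) (hf : MemFlow B gIR h)
    (hg : ∀ t, 0 < g t ∧ g t ≤ 1) (hgF : ∀ t, 1 / (1 + ∑ k ∈ range K, L k * h (t + k) ^ 3 / 2) ≤ g t)
    {k : ℕ} (hk2 : 2 ≤ k) (hkK : k < K) (hL2 : ∀ j, j < K → j ≠ 1 → j ≠ k → L j = 0)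
    (hKL : ∀ k n l, KL k n l = if 0 < k ∧ k < K ∧ l < k then L k * h (n + k) ^ 3 / 2 * ∏ t ∈ Ico (n + 1 + l) (n + k + 1), g t else 0)
    (hθ : ∀ k n l, θ k n l = 1 - (h (n + k + l) / h (n + k)) ^ 3 * ∏ t ∈ Ico (n + k + 1) (n + k + l + 1), g t)
    {ρ : ℕ → ℕ → ℝ} {β : ℕ → ℕ → ℕ → ℝ}
    (hρ : ∀ i n, 1 ≤ i → i ≤ K - 1 → ρ i n = (∑ l ∈ range K, KL i n l) * (1 + ∑ k ∈ Ioc i (K - 1), θ k n i * β (i + 1) n k) /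
      (1 - ∑ k ∈ Ioc i (K - 1), ∑ l ∈ range i, KL k n l))
    (hβnew : ∀ i n, 1 ≤ i → i ≤ K - 1 → β i n i = ρ i n / (1 - ρ i n))
    (hβold : ∀ i n k, 1 ≤ i → i < k → k ≤ K - 1 → β i n k = β (i + 1) n k / (1 - ρ i n))
    {Hg : ℕ → ℕ → ℝ} (hH : ∀ i m, Hg i m = (1 + ∑ k ∈ Ioc i (K - 1), θ k m 1 * β (i + 1) m k) / (1 - ∑ k ∈ Ioc i (K - 1), KL k m 0))
    {c F Hup : ℕ → ℝ} (hc : ∀ n, c n = L k * h (n + k) ^ 3 / 2) (hF : ∀ t, F t = ∑ j ∈ range K, L j * h (t + j) ^ 3 / 2)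
    (hHup : ∀ p, Hup p = (1 + (1 - (h (p + k + 1) / h (p + k)) ^ 3 / (1 + F (p + k + 1))) * ((k * c p) / (1 - k * c p))) / (1 - c p))
    {p : ℕ} (hp : 1 ≤ p) : 0 ≤ Hg 1 p ∧ Hg 1 p ≤ Hup p := by
  have hpos : ∀ n, 0 < h n := fun n => (hh n).1
  have hanti := (strictAnti_of_memFlow hb hlo hh hf).antitone
  have hkr : (2 : ℝ) ≤ k := by exact_mod_cast hk2
  have hck0 : 0 ≤ c p := by rw [hc]; have := hL k; have := hpos (p + k); positivity
  -- the explicit growth factor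
  rw [Hg_one hKL hρ hβnew hβold hH hk2 hkK hL2 p]
  -- the defect: 0 ≤ θ ≤ ϑ
  have hθ0 : 0 ≤ θ k p 1 := defect_nonneg hpos hanti hg hθ k p 1
  have hF0 : ∀ t, 0 ≤ F t := fun t => by
    rw [hF]; exact sum_nonneg fun j _ => by have := hL j; have := hpos (t + j); positivity
  have hr0 : 0 ≤ (h (p + k + 1) / h (p + k)) ^ 3 := by have := hpos (p + k + 1); have := hpos (p + k); positivity
  have hθup : θ k p 1 ≤ 1 - (h (p + k + 1) / h (p + k)) ^ 3 / (1 + F (p + k + 1)) := by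
    rw [hθ, Nat.Ico_succ_singleton, prod_singleton]
    have hgf : 1 / (1 + F (p + k + 1)) ≤ g (p + k + 1) := by rw [hF]; exact hgF (p + k + 1)
    have : (h (p + k + 1) / h (p + k)) ^ 3 / (1 + F (p + k + 1)) ≤ (h (p + k + 1) / h (p + k)) ^ 3 * g (p + k + 1) := by
      rw [div_eq_mul_one_div]; exact mul_le_mul_of_nonneg_left hgf hr0
    linarith
  have hϑ0 : 0 ≤ 1 - (h (p + k + 1) / h (p + k)) ^ 3 / (1 + F (p + k + 1)) := hθ0.trans hθup
  -- the masses: 0 ≤ x̃ ≤ x ≤ 3/4, 0 ≤ KL k p 0 ≤ c p ≤ x/2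
  have hxt0 : 0 ≤ ∑ l ∈ range K, KL k p l := sum_nonneg fun l _ => (kernel_entry_le hL hh hg hKL k p l).1
  have hxtx : ∑ l ∈ range K, KL k p l ≤ k * c p := by rw [hc]; exact row_mass_le hL hh hg hKL hkK p
  have hx34 : k * c p ≤ 3 / 4 := by
    have h1 := load_le_of_window hmono hL hb hlo hdom hh hf hp hkK
    have h2 : 0 ≤ (h (p + k) / h p) ^ 2 := sq_nonneg _
    rw [hc]; linarith
  have hΩ0 : 0 ≤ KL k p 0 := (kernel_entry_le hL hh hg hKL k p 0).1
  have hΩc : KL k p 0 ≤ c p := by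
    have := (kernel_entry_le hL hh hg hKL k p 0).2
    rwa [if_pos (by omega : 0 < k), ← hc] at this
  have hcx : c p ≤ k * c p := by nlinarith
  have hc1 : c p < 1 := by linarith
  -- numerator and denominator
  have hfrac : (∑ l ∈ range K, KL k p l) / (1 - ∑ l ∈ range K, KL k p l) ≤ (k * c p) / (1 - k * c p) := by
    rw [div_le_div_iff₀ (by linarith) (by linarith)]
    nlinarith
  have hfrac0 : 0 ≤ (∑ l ∈ range K, KL k p l) / (1 - ∑ l ∈ range K, KL k p l) := div_nonneg hxt0 (by linarith)
  have hN0 : 0 ≤ 1 + θ k p 1 * ((∑ l ∈ range K, KL k p l) / (1 - ∑ l ∈ range K, KL k p l)) := by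
    have := mul_nonneg hθ0 hfrac0; linarith
  have hNle : 1 + θ k p 1 * ((∑ l ∈ range K, KL k p l) / (1 - ∑ l ∈ range K, KL k p l)) ≤
      1 + (1 - (h (p + k + 1) / h (p + k)) ^ 3 / (1 + F (p + k + 1))) * ((k * c p) / (1 - k * c p)) := by
    have := mul_le_mul hθup hfrac hfrac0 hϑ0; linarith
  refine ⟨div_nonneg hN0 (by linarith), ?_⟩
  rw [hHup]
  calc (1 + θ k p 1 * ((∑ l ∈ range K, KL k p l) / (1 - ∑ l ∈ range K, KL k p l))) / (1 - KL k p 0)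
      ≤ (1 + (1 - (h (p + k + 1) / h (p + k)) ^ 3 / (1 + F (p + k + 1))) * ((k * c p) / (1 - k * c p))) / (1 - KL k p 0) :=
        div_le_div_of_nonneg_right hNle (by linarith)
    _ ≤ (1 + (1 - (h (p + k + 1) / h (p + k)) ^ 3 / (1 + F (p + k + 1))) * ((k * c p) / (1 - k * c p))) / (1 - c p) :=
        div_le_div_of_nonneg_left (hN0.trans hNle) (by linarith) (by linarith)

/-! ## §3 (S-d) at a pin from the damping-free product inequality -/

/-- **(S-d) AT A PIN FROM THE DAMPING-FREE PRODUCT INEQUALITY (★).**  Two-age profile `{1, k}`, `h` a box solution, `g` any damping of the relaxed class,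
the lone kernels `KL` as displayed, any reals `Hg 1 p` with `0 ≤ Hg 1 p ≤ Hup_p` on `[m+2, m+2+k)`, and the coefficients `c_n = L_kh_{n+k}³∕2`,
`d_n = L_1h_{n+1}³∕2`, loads `F_t = Σ_j L_jh_{t+j}³∕2`.  IF
`c_{m+1}·d_{m+1+k}·Π_{p∈[m+2,m+2+k)} Hup_p ≤ c_m·d_{m+1}·(Π_{t∈[m+1,m+k+1)}(1+F_t))⁻¹·(1+F_{m+2})⁻¹·(1 − d_{m+2}·Hup_{m+2})` with `1 − d_{m+2}·Hup_{m+2} ≥ 0`,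
THEN `KL k (m+1) (k−1)·KL 1 (m+1+k) 0·Π_p Hg 1 p ≤ KL k m 0·KL 1 (m+1) 0·(1 − KL 1 (m+2) 0·Hg 1 (m+2))` — the entering entry and the young entries on the
left are at most their undamped coefficients, the leaving entry carries its whole window of dampings, each at least its floor, the young entry at `m+1`
its one damping `g_{m+2} ≥ 1∕(1+F_{m+2})`. [folklore] -/
theorem static_decay_of_product (hL : ∀ k, 0 ≤ L k) (hh : SeqBox γ h)
    (hg : ∀ t, 0 < g t ∧ g t ≤ 1) (hgF : ∀ t, 1 / (1 + ∑ k ∈ range K, L k * h (t + k) ^ 3 / 2) ≤ g t)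
    {k : ℕ} (hk2 : 2 ≤ k) (hkK : k < K)
    (hKL : ∀ k n l, KL k n l = if 0 < k ∧ k < K ∧ l < k then L k * h (n + k) ^ 3 / 2 * ∏ t ∈ Ico (n + 1 + l) (n + k + 1), g t else 0)
    {Hg : ℕ → ℕ → ℝ} {c d F Hup : ℕ → ℝ} (hc : ∀ n, c n = L k * h (n + k) ^ 3 / 2) (hd : ∀ n, d n = L 1 * h (n + 1) ^ 3 / 2)
    (hF : ∀ t, F t = ∑ j ∈ range K, L j * h (t + j) ^ 3 / 2) {m : ℕ}
    (hHg0 : ∀ p ∈ Ico (m + 2) (m + 2 + k), 0 ≤ Hg 1 p) (hHup : ∀ p ∈ Ico (m + 2) (m + 2 + k), Hg 1 p ≤ Hup p)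
    (hpos : 0 ≤ 1 - d (m + 2) * Hup (m + 2))
    (hprod : c (m + 1) * d (m + 1 + k) * ∏ p ∈ Ico (m + 2) (m + 2 + k), Hup p ≤
      c m * d (m + 1) * (∏ t ∈ Ico (m + 1) (m + k + 1), (1 + F t))⁻¹ * (1 + F (m + 2))⁻¹ * (1 - d (m + 2) * Hup (m + 2))) :
    KL k (m + 1) (k - 1) * KL 1 (m + 1 + k) 0 * ∏ p ∈ Ico (m + 2) (m + 2 + k), Hg 1 p ≤
      KL k m 0 * KL 1 (m + 1) 0 * (1 - KL 1 (m + 2) 0 * Hg 1 (m + 2)) := by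
  have hpos' : ∀ n, 0 < h n := fun n => (hh n).1
  have h1K : 1 < K := by omega
  have hF0 : ∀ t, 0 ≤ F t := fun t => by
    rw [hF]; exact sum_nonneg fun j _ => by have := hL j; have := hpos' (t + j); positivity
  have hgF' : ∀ t, 1 / (1 + F t) ≤ g t := fun t => by rw [hF]; exact hgF t
  have hc0 : ∀ n, 0 ≤ c n := fun n => by rw [hc]; have := hL k; have := hpos' (n + k); positivity
  have hd0 : ∀ n, 0 ≤ d n := fun n => by rw [hd]; have := hL 1; have := hpos' (n + 1); positivity
  have hm2 : m + 2 ∈ Ico (m + 2) (m + 2 + k) := by rw [mem_Ico]; omega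
  -- the entries on the left are below their undamped coefficients
  have hent : KL k (m + 1) (k - 1) ≤ c (m + 1) := by
    have := (kernel_entry_le hL hh hg hKL k (m + 1) (k - 1)).2
    rwa [if_pos (by omega : k - 1 < k), ← hc] at this
  have hent0 : 0 ≤ KL k (m + 1) (k - 1) := (kernel_entry_le hL hh hg hKL k (m + 1) (k - 1)).1
  have hyk : KL 1 (m + 1 + k) 0 ≤ d (m + 1 + k) := by
    have := (kernel_entry_le hL hh hg hKL 1 (m + 1 + k) 0).2
    rwa [if_pos Nat.one_pos, ← hd] at this
  have hyk0 : 0 ≤ KL 1 (m + 1 + k) 0 := (kernel_entry_le hL hh hg hKL 1 (m + 1 + k) 0).1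
  have hy2 : KL 1 (m + 2) 0 ≤ d (m + 2) := by
    have := (kernel_entry_le hL hh hg hKL 1 (m + 2) 0).2
    rwa [if_pos Nat.one_pos, ← hd] at this
  have hy20 : 0 ≤ KL 1 (m + 2) 0 := (kernel_entry_le hL hh hg hKL 1 (m + 2) 0).1
  have hP0 : 0 ≤ ∏ p ∈ Ico (m + 2) (m + 2 + k), Hg 1 p := prod_nonneg hHg0
  have hPle : ∏ p ∈ Ico (m + 2) (m + 2 + k), Hg 1 p ≤ ∏ p ∈ Ico (m + 2) (m + 2 + k), Hup p := prod_le_prod hHg0 hHup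
  -- the entries on the right carry their dampings, each at least its floor
  have hlead : c m * (∏ t ∈ Ico (m + 1) (m + k + 1), (1 + F t))⁻¹ ≤ KL k m 0 := by
    rw [hKL, if_pos ⟨by omega, hkK, by omega⟩, ← hc, show m + 1 + 0 = m + 1 by ring]
    exact mul_le_mul_of_nonneg_left (inv_prod_le_prod_damping hF0 hgF' _) (hc0 m)
  have hy1 : d (m + 1) * (1 + F (m + 2))⁻¹ ≤ KL 1 (m + 1) 0 := by
    rw [hKL, if_pos ⟨Nat.one_pos, h1K, Nat.one_pos⟩, ← hd, show m + 1 + 1 + 0 = m + 2 by ring, show m + 1 + 1 + 1 = m + 2 + 1 by ring,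
      Nat.Ico_succ_singleton, prod_singleton, inv_eq_one_div]
    exact mul_le_mul_of_nonneg_left (hgF' (m + 2)) (hd0 (m + 1))
  have hlast : 1 - d (m + 2) * Hup (m + 2) ≤ 1 - KL 1 (m + 2) 0 * Hg 1 (m + 2) := by
    have := mul_le_mul hy2 (hHup _ hm2) (hHg0 _ hm2) (hd0 (m + 2)); linarith
  have hK0 : 0 ≤ KL k m 0 := (kernel_entry_le hL hh hg hKL k m 0).1
  have hK10 : 0 ≤ KL 1 (m + 1) 0 := (kernel_entry_le hL hh hg hKL 1 (m + 1) 0).1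
  have hA0 : 0 ≤ c m * (∏ t ∈ Ico (m + 1) (m + k + 1), (1 + F t))⁻¹ :=
    mul_nonneg (hc0 m) (inv_nonneg.mpr (prod_nonneg fun t _ => by have := hF0 t; positivity))
  have hB0 : 0 ≤ d (m + 1) * (1 + F (m + 2))⁻¹ := mul_nonneg (hd0 (m + 1)) (inv_nonneg.mpr (by have := hF0 (m + 2); positivity))
  calc KL k (m + 1) (k - 1) * KL 1 (m + 1 + k) 0 * ∏ p ∈ Ico (m + 2) (m + 2 + k), Hg 1 p
      ≤ c (m + 1) * d (m + 1 + k) * ∏ p ∈ Ico (m + 2) (m + 2 + k), Hup p :=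
        mul_le_mul (mul_le_mul hent hyk hyk0 (hc0 _)) hPle hP0 (mul_nonneg (hc0 _) (hd0 _))
    _ ≤ c m * d (m + 1) * (∏ t ∈ Ico (m + 1) (m + k + 1), (1 + F t))⁻¹ * (1 + F (m + 2))⁻¹ * (1 - d (m + 2) * Hup (m + 2)) := hprod
    _ = (c m * (∏ t ∈ Ico (m + 1) (m + k + 1), (1 + F t))⁻¹) * (d (m + 1) * (1 + F (m + 2))⁻¹) * (1 - d (m + 2) * Hup (m + 2)) := by ring
    _ ≤ KL k m 0 * KL 1 (m + 1) 0 * (1 - KL 1 (m + 2) 0 * Hg 1 (m + 2)) :=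
        mul_le_mul (mul_le_mul hlead hy1 hB0 hK0) hlast hpos (mul_nonneg hK0 hK10)

/-! ## §4 The two-age END on the product inequality (★) -/

/-- **ROUTE (N), FIRST ORDER, END FOR TWO-AGE FLOWS — ON THE DAMPING-FREE PRODUCT INEQUALITY (★), EVERY DAMPING IN THE RELAXED CLASS.**  As (E83k)
`flow_nonneg_two_ages_decay` (two-age profile `{1, k}`, `2 ≤ k`, horizon `K = k + 1`; `h` a box solution; `g` any damping with `1∕(1+F_t) ≤ g_t ≤ 1`; the
first-order objects of route (N) as in (E81k)), with its one static hypothesis (S-d) REPLACED by: at every pin `m`, with `c_n = L_kh_{n+k}³∕2`,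
`d_n = L_1h_{n+1}³∕2`, `F_t = Σ_j L_jh_{t+j}³∕2` and `Hup_p = (1 + ϑ_p·kc_p∕(1−kc_p))∕(1 − c_p)`, `ϑ_p = 1 − (h_{p+k+1}∕h_{p+k})³∕(1 + F_{p+k+1})`,
**`c_{m+1}·d_{m+1+k}·Π_{p∈[m+2,m+2+k)} Hup_p ≤ c_m·d_{m+1}·(Π_{t∈[m+1,m+k+1)}(1+F_t))⁻¹·(1+F_{m+2})⁻¹·(1 − d_{m+2}·Hup_{m+2})`** and `d_{m+2}·Hup_{m+2} ≤ 1` —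
an inequality between the levels and the loads alone, with no damping in it.  CONCLUSION: the comparison surplus `ε` of every admissible excess `e` is
non-negative.  (§2 `Hg_one_le`, §3 `static_decay_of_product`, (E83k).) [folklore] -/
theorem flow_nonneg_two_ages_of_product (hmono : ∀ u v : ℕ → ℝ, SeqBox γ u → SeqBox γ v → (∀ j, u j ≤ v j) → B u ≤ B v)
    (hL : ∀ k, 0 ≤ L k) (hb : 0 < b) (hlo : ∀ u, SeqBox γ u → b ≤ B u) (hdom : ∀ u, SeqBox γ u → ∑ k ∈ range K, L k * u k ≤ B u)
    (hh : SeqBox γ h) (hf : MemFlow B gIR h)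
    (hg : ∀ t, 0 < g t ∧ g t ≤ 1) (hgF : ∀ t, 1 / (1 + ∑ k ∈ range K, L k * h (t + k) ^ 3 / 2) ≤ g t)
    {k : ℕ} (hk2 : 2 ≤ k) (hKk : K = k + 1) (hL2 : ∀ j, j < K → j ≠ 1 → j ≠ k → L j = 0)
    (hKL : ∀ k n l, KL k n l = if 0 < k ∧ k < K ∧ l < k then L k * h (n + k) ^ 3 / 2 * ∏ t ∈ Ico (n + 1 + l) (n + k + 1), g t else 0)
    (hθ : ∀ k n l, θ k n l = 1 - (h (n + k + l) / h (n + k)) ^ 3 * ∏ t ∈ Ico (n + k + 1) (n + k + l + 1), g t)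
    {KA : ℕ → ℕ → ℕ → ℝ} {RL RA SL SA : ℕ → (ℕ → ℝ) → ℕ → ℝ}
    (hRL : ∀ i v m, RL i v m = ∑ l ∈ range K, KL i m l * v (m + 1 + l))
    (hRA : ∀ i v m, RA i v m = ∑ l ∈ range K, KA i m l * v (m + 1 + l))
    (hKA : ∀ i m l, KA i m l = KL i m l + KA (i + 1) m l) (hKAtop : ∀ m l, KA K m l = 0)
    (hSL : ∀ i (w : ℕ → ℝ), (∀ m, K < m → w m = 0) → (∀ m, K < m → SL i w m = 0) ∧ ∀ m, SL i w m = w m - RL i (SL i w) m)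
    (hSA : ∀ i (w : ℕ → ℝ), (∀ m, K < m → w m = 0) → (∀ m, K < m → SA i w m = 0) ∧ ∀ m, SA i w m = w m - RA i (SA i w) m)
    {ρ : ℕ → ℕ → ℝ} {β : ℕ → ℕ → ℕ → ℝ}
    (hρ : ∀ i n, 1 ≤ i → i ≤ K - 1 → ρ i n = (∑ l ∈ range K, KL i n l) * (1 + ∑ k ∈ Ioc i (K - 1), θ k n i * β (i + 1) n k) /
      (1 - ∑ k ∈ Ioc i (K - 1), ∑ l ∈ range i, KL k n l))
    (hβnew : ∀ i n, 1 ≤ i → i ≤ K - 1 → β i n i = ρ i n / (1 - ρ i n))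
    (hβold : ∀ i n k, 1 ≤ i → i < k → k ≤ K - 1 → β i n k = β (i + 1) n k / (1 - ρ i n))
    {Hg : ℕ → ℕ → ℝ} (hH : ∀ i m, Hg i m = (1 + ∑ k ∈ Ioc i (K - 1), θ k m 1 * β (i + 1) m k) / (1 - ∑ k ∈ Ioc i (K - 1), KL k m 0))
    {c d F Hup : ℕ → ℝ} (hc : ∀ n, c n = L k * h (n + k) ^ 3 / 2) (hd : ∀ n, d n = L 1 * h (n + 1) ^ 3 / 2)
    (hF : ∀ t, F t = ∑ j ∈ range K, L j * h (t + j) ^ 3 / 2)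
    (hHup : ∀ p, Hup p = (1 + (1 - (h (p + k + 1) / h (p + k)) ^ 3 / (1 + F (p + k + 1))) * ((k * c p) / (1 - k * c p))) / (1 - c p))
    (hpos : ∀ m, d (m + 2) * Hup (m + 2) ≤ 1)
    (hprod : ∀ m, c (m + 1) * d (m + 1 + k) * ∏ p ∈ Ico (m + 2) (m + 2 + k), Hup p ≤
      c m * d (m + 1) * (∏ t ∈ Ico (m + 1) (m + k + 1), (1 + F t))⁻¹ * (1 + F (m + 2))⁻¹ * (1 - d (m + 2) * Hup (m + 2)))
    {M : ℕ → ℕ → ℝ} (hM : ∀ i m, M i m = KL i m 0 + ∑ l ∈ range (K - 1), max (KL i m (l + 1) - KL i (m + 1) l) 0)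
    {HgS : ℕ → ℕ → ℕ → ℝ} (hHS : ∀ i j m, HgS i j m = (1 + ∑ k ∈ Ioc i (K - 1), θ k m 1 * β (i + 1) m k) /
      (1 - ∑ k ∈ Ioc i (K - 1), (KL k m 0 - if m + 1 + k ≤ j then KL k (m + 1) (k - 1) else 0)))
    {e ε : ℕ → ℝ} (he0 : ∀ m, 0 ≤ e m) (hea : ∀ m, e (m + 1) ≤ e m) (het : ∀ m, K < m → e m = 0)
    (hεt : ∀ m, K < m → ε m = 0) (hεrec : ∀ m, ε m = e m - RA 1 ε m) : ∀ m, 0 ≤ ε m := by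
  have hkK : k < K := by omega
  have hHg := fun (p : ℕ) (hp : 1 ≤ p) =>
    Hg_one_le hmono hL hb hlo hdom hh hf hg hgF hk2 hkK hL2 hKL hθ hρ hβnew hβold hH hc hF hHup hp
  refine flow_nonneg_two_ages_decay hmono hL hb hlo hdom hh hf hg hgF hk2 hKk hL2 hKL hθ hRL hRA hKA hKAtop hSL hSA hρ hβnew hβold hH
    (fun m => ?_) hM hHS he0 hea het hεt hεrec
  exact static_decay_of_product hL hh hg hgF hk2 hkK hKL hc hd hF
    (fun p hp => (hHg p (by rw [mem_Ico] at hp; omega)).1) (fun p hp => (hHg p (by rw [mem_Ico] at hp; omega)).2)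
    (by linarith [hpos m]) (hprod m)

end Summit.QuantumFields.BalabanUV.Beta.EriceRemainderEnclosureHistoryAutonomyComparisonAgeCompositionDecayReduction

end
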